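import Mathlib
import HarnessLib
import HarnessLib.Audit
import Summits.NavierStokesRegularity.Statement
import Literature.Analysis.FluidPDE.ClassicalSolution
import Literature.Analysis.FluidPDE.LerayHopf
import Literature.Analysis.FluidPDE.SelfSimilar
import HarnessLib.Audit.Status.Attr

/-!
Route: PeriodicPortability

DORMANT since 2026-08-29T19:39:47Z (census g0: costume|duplicate of —; reader census-reader-53-g0) — unstaffed, not closed; items shared with open routes are served there. `ledger route dormant <id> --off` reactivates.

# Route PeriodicPortability — Clay (B) implies Clay (A) once an unforced whole-space breakdown can
be transplanted into a flat torus

CONDITIONAL BRIDGE on the printed Clay statement (B)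
(`Literature.Analysis.FluidPDE.NavierStokesExistenceSmoothPeriodic`, registered
OPEN CONJECTURE): it suffices to show X = BlowupPeriodises — "an unforced whole-space singularity
can be transplanted into some flat
torus", typed since rev 6 in the A-form: whenever a smooth divergence-free rapidly decaying datum u₀
on ℝ³ admits NO Clay-(A) solution
of NS_ν (the unforced instance of Clay (C) at u₀; by the in-tree local theory this says exactly that
the classical Leray–Hopf
evolution of u₀ fails to extend smoothly past some finite T), some smooth divergence-free
ℤ³-periodic datum ψ admits NO printed-(B)
solution at ν (no jointly smooth (v,q) with v periodic; the pressure is left free exactly as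
Fefferman prints (10), so the Galilean
loophole is on the side that makes X harder, i.e. honest). Then (B) ∧ X ⇒ (A) by five lines of
logic. The route
resurrects the unfinished 2001 line summits/ns/routes/threshold-rigidity (STATUS proving) §10 "The
periodic problem sees the
whole-space minimal radius" (Thm t:periodic, Cor c:periodic, Rem r:periodic, Question q:L2;
claim-level there, never minted as a wall)
and re-types its one missing step — blow-up, not merely amplification, survives truncation +
periodisation — as the crux.
Lean: `∀ ν : ℝ, 0 < ν → ∀ u₀ : EuclideanSpace ℝ (Fin 3) → EuclideanSpace ℝ (Fin 3), ContDiff ℝ (⊤ :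
ℕ∞) u₀ → Literature.Analysis.FluidPDE.NSWave0.IsDivFree u₀ →
Literature.Analysis.FluidPDE.HasRapidSpatialDecay u₀ → (¬ ∃ (u : ℝ → EuclideanSpace ℝ (Fin 3) →
EuclideanSpace ℝ (Fin 3)) (p : ℝ → EuclideanSpace ℝ (Fin 3) → ℝ),
Literature.Analysis.FluidPDE.IsSmoothOnHalfSpace u ∧
Literature.Analysis.FluidPDE.IsSmoothOnHalfSpace p ∧
Literature.Analysis.FluidPDE.IsNavierStokesSolution ν 0 u₀ u p ∧
Literature.Analysis.FluidPDE.HasBoundedEnergy u) → ∃ ψ : EuclideanSpace ℝ (Fin 3) → EuclideanSpace ℝ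
(Fin 3), ContDiff ℝ (⊤ : ℕ∞) ψ ∧ Literature.Analysis.FluidPDE.NSWave0.IsDivFree ψ ∧
Literature.Analysis.FluidPDE.IsLatticePeriodic ψ ∧ ¬ ∃ (v : ℝ → EuclideanSpace ℝ (Fin 3) →
EuclideanSpace ℝ (Fin 3)) (q : ℝ → EuclideanSpace ℝ (Fin 3) → ℝ),
Literature.Analysis.FluidPDE.IsSmoothOnHalfSpace v ∧
Literature.Analysis.FluidPDE.IsSmoothOnHalfSpace q ∧
Literature.Analysis.FluidPDE.IsNavierStokesSolution ν 0 ψ v q ∧ ∀ t, 0 ≤ t →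
Literature.Analysis.FluidPDE.IsLatticePeriodic (v t)`

## Assembly
Pure logic given the declared condition: assume (B) and BlowupPeriodises; to prove (A) fix ν > 0 and
a Clay datum u₀ and suppose
no Clay-(A) solution issues from it; BlowupPeriodises yields a periodic datum ψ with no printed-(B)
solution at ν, contradicting (B)
at (ν, ψ). The deciding theorem `closes (hP : BlowupPeriodises) (hB : ClayB) :
NavierStokesRegularity` is this argument (crux-only
hypotheses; ClayB = the declared condition written out as an item; Sketch.lean rc 0, axioms
propext/Classical.choice/Quot.sound).
The route file imports no `Theorems.*` module: its cone is the 24-module closure of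
ClassicalSolution / LerayHopf / SelfSimilar /
Statement with 0 unproved named facts (rev ≤ 5 invoked the proved frame
Theorems.navierStokesRegularity_of_noBlowup inside
`closes`; that import alone carried 31 unproved, unused named facts into the module cone and blocked
staffing).

CONDITIONAL on Literature.Analysis.FluidPDE.NavierStokesExistenceSmoothPeriodic — this route is an explicit reduction to that named conjecture (D-0019: crux floor waived).

Rationale: WHY THIS LINE. Tao's localisation theory (Tao2011 = arXiv:1108.1165, Thm 1.20 and Fig. 1) derives
Clay (A) only from the FORCED periodic H¹
conjecture (his Conj. 1.9 ⇒ 1.19 ⇒ 1.13 ⇒ 1.3); from the homogeneous periodic statement (B) (his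
Conj. 1.4) nothing flows to (A) in
print, because truncating a singular solution to a CKN annulus manufactures a force (ibid. Rem. 81)
and removing it needs stability of
the singularity. The 2001 programme proved (claim-level, 2 pp.) the δ-free half: a whole-space
blow-up datum forces periodic data of
nearby critical norm with arbitrarily large critical amplification (TRP Thm t:periodic), hence
"periodic critical a priori bound ⇒
G = X ⊃ (A)" (TRP Cor c:periodic), and isolated the residue as one question asked three ways — B ≠ ∅
⇒ B ∩ 𝒮 ≠ ∅? ρ_𝕋 ≤ ρ_ℝ? does
(A) exclude thresholds? (TRP Q q:L2, Rem r:periodic(2): "the questions are in fact the same one") —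
i.e. STABILITY OF BLOW-UP UNDER
TRUNCATION AND PERIODISATION OF THE DATUM; Robinson (arXiv:2008.04725, Nonlinearity 2021, §7) proves
the regularity direction ℝ³ → 𝕋³_L
and states that the full transfer "appears to require much more sophisticated methods". This route
puts exactly that residue on the
board as a typed crux deciding (A) given (B), with a concrete engine imported from the 2001 wall-(a)
result W-T (Type-I SS/DSS/RSS
profile ⇒ blow-up from C_c^∞ data by finite-codimension Lyapunov–Perron landing with compactly
supported correctors in L^p similarity
variables; internal-ns-w-typeI-profile-truncation y1/y2/y3/neg-y1, four independent in-programme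
proofs): in similarity variables
about the singular point the period L/√(T−t) → ∞, so the periodic images are an exponentially
receding non-autonomous perturbation —
the favourable regime for the same landing scheme (support RdssProfilePeriodises is its first rung).
No existing route uses (B) or
the ℝ³ → 𝕋³ direction (RobustBlowupPortability transplants a ROBUST TORUS scenario to ℝ³, the
converse direction and negative polarity).
Imported areas: dynamical-systems stable-manifold theory (finite-codimension landing),
concentration-compactness on tori (Gal01-type
profile decomposition), Tao's localised enstrophy/uniqueness theory (in tree:
tao_unconditional_uniqueness_velocity_holds).

RANKED CRUXES. #2 BlowupPeriodises (crux) — BLOW-UP PERIODISES, A-form since rev 6 (TRP Q q:L2 / Rem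
r:periodic(2), re-typed to decide (A) given (B)): for every ν > 0 and every smooth divergence-free
rapidly decaying datum u₀ on ℝ³ from which NO Clay-(A) solution of unforced NS_ν issues (no jointly
smooth (u,p) on ℝ³×[0,∞) from u₀ with bounded energy — the unforced instance of Clay (C) at u₀, i.e.
by the in-tree local theory: the classical Leray–Hopf evolution of u₀ blows up in finite time),
there is a smooth divergence-free ℤ³-periodic datum ψ from which NO jointly smooth (v,q) on ℝ³×[0,∞)
with v(·,t) periodic solves NS_ν (pressure unconstrained, as printed in (B)). Equivalent to the
rev-≤5 blow-up form (hypotheses: classical (u,p) on ℝ³×[0,T), Leray–Hopf from its rapidly decaying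
datum, no smooth extension past T) over PROVED tree theorems — ⇐ by the pointwise local theory
inside Theorems.navierStokesRegularity_of_noBlowup (Kato maximal solution,
clay_solution_of_hasGlobalKatoSolution_holds, KatoMaximalTimeSingular; old-form ∧
pointwise-local-theory → A-form is pure logic, planner Sketch.lean `blowupPeriodises_of_LH` rc 0), ⇒
by tao_unconditional_uniqueness_velocity_holds (Tao2011 Cor. 11.4). Re-typed by the cone
route-repair (rev 6) so that `closes` is pure logic over the two crux items and the route file
imports no Theorems module. [difficulty: open-problem] (why it might fail: Blow-up need not survive
a far-field change of the datum: if ∂G is wild (no finite-codim stable manifold; TRP alternative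
(iii), M ∩ L² = ∅), every periodisation may land on the global side with no finite corrector family
to re-land it (Tao Rem 81 then gives only a FORCED periodic singularity).) [Tao2011,
arXiv:1108.1165, RusinSverak2011, arXiv:2008.04725, doi:10.1088/1361-6544/ac2673, FeffermanClay2006]
#9 PeriodicAmplificationTransplant (support) — (2001 TRP Thm t:periodic "whole-space blow-up forces
unbounded periodic amplification", L³-cell/sup-norm form, claim-level in 2001 — to be re-proved
here; stated over a blow-up solution as before) for every ν > 0, T > 0 and every classical solution
(u,p) of unforced NS_ν on ℝ³×[0,T), Leray–Hopf from its rapidly decaying datum, with no smooth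
extension past T, there is M such that for every A some smooth divergence-free ℤ³-periodic MEAN-ZERO
datum ψ with ‖ψ‖_(L³(unit cell)) ≤ M has: every GLOBAL classical periodic solution (v and q
periodic) from ψ reaches √t‖v(t)‖_∞ ≥ A at some t > 0 (mean zero + periodic pressure exclude
Galilean drift, so this is genuine critical amplification at a bounded critical level; proof sketch:
evolve to u(t₀), solenoidally truncate at R ≫ 1, rescale into the unit torus, compare periodic and
whole-space evolutions up to t₁ < T by the energy method on the difference with CKN/ε-regularity
control of the far field, and use blow-up of the whole-space sup-norm rate ‖u(t)‖_∞ ≥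
c(ν/(T−t))^(1/2)). [difficulty: M] [RusinSverak2011, Tao2011, arXiv:2008.04725,
GallagherIftimiePlanchon2003]
#9 RdssProfilePeriodises (support) — (periodic twin of the shared bridge RdssProfileTruncation of
routes FilamentSkeletonRss/DssFarFieldSlaving; engine = the 2001 wall-(a) theorem W-T, proved there
four times) a nontrivial Type-I rotated discretely self-similar ancient mild profile (ν = 1,
measurable slices, |u| ≤ C₀/(|x|+√−t)) forces the failure of printed Clay (B) at ν = 1: land the
truncated, periodised profile on the finite-codimension strong-stable manifold of the profile's
periodic orbit in L^p_σ similarity variables (3 < p < ∞), the periodic images being an exponentially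
receding perturbation as s → ∞; the Galilean normalisation (NSWave0 module docstring) turns
"periodic mild blow-up" into "no printed-(B) solution". [difficulty: L] [BradshawTsai2017CPDE,
arXiv:2607.09619, Tao2011, RusinSverak2011]
#9 ClayB (crux by kind.auto-crux, conjecture-grade; THE DECLARED CONDITION of this conditional
bridge, never to be staffed here) — printed Clay (B), written out verbatim = the body of the
registered OPEN CONJECTURE `Literature.Analysis.FluidPDE.NavierStokesExistenceSmoothPeriodic`
(`ClayB ↔ NavierStokesExistenceSmoothPeriodic` is `Iff.rfl`, checked in Sketch.lean): for every ν >
0 every smooth divergence-free ℤ³-periodic datum has a jointly smooth solution (u,p) on ℝ³×[0,∞)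
with u(·,t) periodic. [difficulty: open-problem] [FeffermanClay2006, Tao2011]
Dropped at rev 6 (cone route-repair): NoBlowupToClay (stmt-NavierStokesRegularity-15607, verbatim
the PROVED shared frame stmt-0055) — no longer load-bearing once the crux is in A-form (the deciding
theorem needs no local theory), and its `_holds` link / Theorems import is exactly what carried the
31 unproved, unused named facts of the NS local-theory library into this route's module cone; the
item keeps its other routes.

TWO-LAYER PLAN. Foreseen splits of BlowupPeriodises once a rung closes (not filed now). Zeroth
(provable glue = pure logic, certified in Sketch.lean as `blowupPeriodises_of_LH`): BlowupPeriodises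
⇐ [LH: the rev-≤5 blow-up form — a classical Leray–Hopf solution from a rapidly decaying datum with
no smooth extension past T forces a periodic datum with no printed-(B) solution] ∧
[ClayFailureBlowsUp: failure of (A) at u₀ yields such a blow-up solution from u₀ — the pointwise
content of the in-tree proof of NoBlowupToClay, provable-now, M]. Then LH ⇐ [TS_c: a Clay-class
blow-up yields a
COMPACTLY SUPPORTED smooth blow-up datum (truncation stability on ℝ³)] → [PER: a compactly supported
ℝ³ blow-up datum periodises with
blow-up for all large periods] → LH; and PER ⇐ [hyperbolicity/finite codimension of the minimal
(threshold) blow-up] →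
[Lyapunov–Perron landing with periodic correctors] → PER, calibrated first on the Type-I (R)DSS case
(RdssProfilePeriodises).

KILL CRITERIA. A whole-space Clay-class singularity that provably admits NO periodic shadow (e.g. a
blow-up whose mechanism needs infinite-energy
tails or the non-compact translation group in an essential way) refutes BlowupPeriodises ⇒ close
`refuted:BlowupPeriodises` and bank
"(A) and (B) are genuinely different problems" as a barrier note. A proof of Clay (B)'s NEGATION
moots the bridge (hypothesis false ⇒
close superseded/moot). A proof that B ≠ ∅ ⇒ int B ≠ ∅ in Ḣ^½ (no fragile blow-up; ThinOrFatPincer's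
Inflation jaw) makes the crux
follow from TRP Prop p:schwartz + periodisation of a robust Schwartz blow-up — pivot to that
derivation.

NOT DECOMPOSED YET. The truncation step (ℝ³, Schwartz → C_c^∞) and the periodisation step are kept
inside one crux at open; the Galilean pressure
normalisation turning "periodic mild blow-up" into "no printed-(B) solution" (elementary; NSWave0
docstring remark + Tao2011 Lemma
4.1/Cor. 11.4 in tree) is left to the prover of the crux/supports; no periodic Ḣ^½ vocabulary is
requested (amplification is typed
with the L³ norm on the unit cell and the scale-invariant √t‖·‖_∞). Since rev 6 the
pressure-free local-theory step "¬(A) at u₀ ⇒ the classical Leray–Hopf evolution of u₀ blows up at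
some finite T" is folded into
the crux (it is provable now from tree theorems — Kato maximal solution,
clay_solution_of_hasGlobalKatoSolution_holds,
KatoMaximalTimeSingular, as assembled inside Theorems.navierStokesRegularity_of_noBlowup — and a
prover files it as a helper with
`--supports` the crux, in a Theorems file importing this route file, never as a Theses-free twin
linked into this file).

CHEAPEST FALSIFIER. Lookup: a published statement "Clay (B) ⇒ Clay (A)" or "Schwartz regularity ⇒
Ḣ^½/H¹ regularity" would make the crux known —
searched (below): not found; Tao2011 Fig. 1 and Robinson 2021 §7 both record the implication as
missing. Mathematical: exhibit, in
Tao's averaged class where blow-up EXISTS (tree `Tao2016.averagedNS_blowup_holds`), that the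
averaged blow-up does NOT periodise —
if even there blow-up periodises (expected: the cascade is frequency-localised and periodises
verbatim), the crux is at least
consistent with every known blow-up mechanism; if it fails there, the failure mode names the
obstruction for NS.

NUMBERS. Tao2011 Thm 1.20: proved 1.9⇔1.10, 1.13⇔1.14⇔1.15⇔1.16⇔1.17, 1.18⇔1.19, 1.6⇔1.4; one-way
1.9⇒1.8⇒1.4, 1.9⇒1.19⇒1.13, 1.19⇒1.5⇒1.3;
NO arrow from 1.4 (= Clay B) or 1.3 (= Clay A) upward. 2001 TRP §10: F_per(ρ) = ∞ for every ρ > ρ_ℝ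
(Thm t:periodic); trichotomy
Rem r:schwartz: exactly one of (i) G = X, (ii) some Schwartz datum blows up, (iii) (A) holds with ∂G
≠ ∅ non-Schwartz thresholds.
W-T landing (2001): corrector size |a| ≤ C R^(−(p−3)/p) in L^p_σ, 3 < p < ∞; T_max exact.

DEFINITION REQUESTS. None at open. (A periodic homogeneous Ḣ^½/L³ data vocabulary on `UnitAddTorus`
would let PeriodicAmplificationTransplant be stated
in TRP's original Ḣ^½(𝕋³) form; not needed for the deciding chain.)

Novelty: Searches (2026-08-16): `lit search "periodic Navier-Stokes regularity whole space transfer torus"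
--source zbmath` (1 hit,
Robinson–Sadowski 2014, local criterion, unrelated); `lit search "Navier-Stokes periodic domain
whole space equivalence global
regularity problem" --source s2` (10; hit #2/#4 = Robinson arXiv:2008.04725 "transfer of
regularity", read §7: only ℝ³-regular ⇒
𝕋³_L-regular for a FIXED datum, full transfer stated open); `lit read arxiv:1108.1165` (Tao2011 Thm
1.20, Prop 7, Rem 81 read:
no (B) ⇒ (A)); `lit galaxy search "periodic Navier-Stokes implies whole space" --star all` (0),
`"localisation and compactness
properties of the Navier-Stokes" --star all` (0), `"sensitive to the decay hypotheses" --star all`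
(0); `ledger negatives` (3, none
related); tree grep: no Theses file mentions NavierStokesExistenceSmoothPeriodic as hypothesis;
archive: TRP §10 + Q q:L2 (2001,
unminted). lit searchd was down (ConnectionReset) — local hybrid search not run; OpenAlex budget
exhausted.
Nearest prior art found: Tao2011 (arXiv:1108.1165) Thm 1.20/Rem 81 — (A) from the FORCED periodic H¹
conjecture, periodic
singularity ⇒ FORCED whole-space singularity; arXiv:2008.04725 (Robinson 2021) Thm 7.1 — regularity
transfers ℝ³ → large torus for a
fixed datum; 2001 TRP Thm t:periodic/Cor c:periodic (internal, claim-level) — amplification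
transfers, periodic critical a priori
bound ⇒ (A); route RobustBlowupPortability (tree) — converse direction 𝕋³ ⇒ ℝ³, negative side.
Delta: the first t  [refs: 2008.04725, 1108.1165, arxiv:1108.1165, Tao2011]

Barriers (technique_class: localisation, blowup-portability, stability-of-blowup): - technique_class: localisation, blowup-portability, stability-of-blowup
- Literature.Barriers.NavierStokesRegularity.EnergySupercriticality: not engaged in form — the crux
is a qualitative stability statement about one singular solution, not an a priori estimate; it IS
engaged in any perturbative proof, which must control the periodic/whole-space difference up to the
singular time: the bet is finite-codimension landing on the profile's stable manifold (structure of
the singularity, not energy) as in the 2001 W-T theorem.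
- Literature.Barriers.NavierStokesRegularity.TaoAveragedBlowup: consistent — the crux does not
exclude blow-up; in Tao's averaged class blow-up exists and (expected) periodises, so an
averaging-insensitive proof of the crux is conceivable and NOT barred; the barrier bites only the
hypothesis (B), which this route does not attack.
- Literature.Barriers.NavierStokesRegularity.ForcedLerayHopfNonuniquenessNarrow: the printed (B)
class (free pressure) is non-unique by Galilean boosts (Tao2011 Prop 7); the crux concludes
non-existence of ANY printed-(B) solution, so its prover must pass through the normalised-pressure
(periodic mild) class and the elementary Galilean absorption of the affine pressure part — recorded
as a design constraint, not an obstruction (boosts preserve singularities).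
- Literature.Barriers.NavierStokesRegularity.CriticalNormBlowupNecessity: used, not fought — blow-up
forces ‖u(t)‖_∞ ≥ c(ν/(T−t))^(1/2) and divergence of critical norms, which

History (route lifecycle, newest last):
- 2026-08-16T18:07:07Z · rev 7: restated BlowupPeriodises (stmt-NavierStokesRegularity-16042) — route-repair(cone), unit rrepair-NavierStokesRegularity-Periodi-c77472d4, rev 6: RE-ROUTED AROUND the 31 unproved named facts of the dispatch — all 31 entered t (planner-rrepair-NavierStokesRegularity-Periodi-c77472d4-0)
- 2026-08-16T18:07:07Z · rev 7: dropped NoBlowupToClay — route-repair(cone), unit rrepair-NavierStokesRegularity-Periodi-c77472d4, rev 6: RE-ROUTED AROUND the 31 unproved named facts of the dispatch — all 31 entered t (planner-rrepair-NavierStokesRegularity-Periodi-c77472d4-0)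
- 2026-08-24T13:43:11Z · DORMANT — reconciler: no traction for 6.8 d (last activity item-evidence-added at 2026-08-17T17:46:25Z); parked, not closed — `ledger route dormant route-NavierStokesRegu (operator:999:1877502)
- 2026-08-27T05:13:12Z · REACTIVATED — reconciler: reactivated — activity item-proof-filed at 2026-08-27T03:56:28Z after parking at 2026-08-24T13:43:11Z (operator:999:1455747)
- 2026-08-29T19:39:47Z · DORMANT — census g0: costume|duplicate of —; reader census-reader-53-g0 (operator:999:1567255)

sub-problem: NavierStokesRegularity · status: dormant · opened planner-plan-lens-NavierStokesRegularity-resurrect2001-v2-n1-0 2026-08-16T17:11:34Z · rev 7 · ledger route-NavierStokesRegularity-PeriodicPortability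
GENERATED by the gate from the ledger (D-0016/17). Provers cite these decls: `theorem foo : Summit.NavierStokesRegularity.NavierStokesRegularity.Theses.PeriodicPortability.<Decl> := …` in Summits/NavierStokesRegularity/NavierStokesRegularity/Theorems/<Name>.lean.
-/

namespace Summit.NavierStokesRegularity.NavierStokesRegularity.Theses.PeriodicPortability

open scoped BigOperators Topology Manifold Classical MeasureTheory ProbabilityTheory Matrix InnerProductSpace ComplexConjugate ContinuousMap
open Filter Set Function TopologicalSpace MeasureTheory

attribute [summit_statement] _root_.NavierStokesRegularity

open Literature.NS

-- earlier BlowupPeriodises (stmt-NavierStokesRegularity-16042, replaced 2026-08-16T18:07:07Z -> stmt-NavierStokesRegularity-16203): retired by None — ∀ ν : ℝ, 0 < ν → ∀ T : ℝ, 0 < T → ∀ (u : ℝ → EuclideanSpace ℝ (Fin 3) → EuclideanSpace ℝ (Fin 3)) (p : ℝ → EuclideanSpace ℝ (Fin 3) → ℝ), Literature.Analysis.FluidPDE.IsClassicalNSSolutionOn (Set.Ico 0 T) ν 0 u p → Literature.Analysis.FluidPDE.IsLerayH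
/-- item stmt-NavierStokesRegularity-16203 · crux · rank 2 · open · by planner
why it might fail: Blow-up need not survive a far-field change of the datum: if ∂G is wild (no finite-codim stable manifold; TRP alternative (iii), M ∩ L² = ∅), every periodisation may land on the global side with no finite corrector family to re-land it (Tao Rem 81 then gives only a FORCED periodic singularity).
sources: Tao2011, arXiv:1108.1165, RusinSverak2011, arXiv:2008.04725, doi:10.1088/1361-6544/ac2673, FeffermanClay2006
[crux] BLOW-UP PERIODISES — A-form (rev 6, cone route-repair; TRP Q q:L2 / Rem r:periodic(2)
re-typed to decide (A) given (B)): for every ν > 0 and every smooth divergence-free rapidly decaying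
datum u₀ on ℝ³ from which NO Clay-(A) solution of unforced NS_ν issues (no jointly smooth (u,p) on
ℝ³×[0,∞) from u₀ with bounded energy — the unforced instance of Clay (C) at u₀; by the in-tree local
theory this says exactly that the classical Leray–Hopf evolution of u₀ fails to extend smoothly past
some finite T), there is a smooth divergence-free ℤ³-periodic datum ψ from which NO jointly smooth
(v,q) on ℝ³×[0,∞) with v(·,t) periodic solves NS_ν (pressure unconstrained, as printed in (B)).
Equivalent to the rev-≤5 blow-up form (hypotheses: classical (u,p) on ℝ³×[0,T), Leray–Hopf from its
rapidly decaying datum, no smooth extension past T) over PROVED tree theorems: ⇐ by the pointwise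
local theory inside Theorems.navierStokesRegularity_of_noBlowup (Kato maximal solution;
clay_solution_of_hasGlobalKatoSolution_holds; KatoMaximalTimeSingular) — old-form ∧
pointwise-local-theory → A-form is pure logic (planner Sketch.lean `blowupPeriodises_of_LH`, rc 0);
⇒ by tao_unconditional_uniqueness_veloci -/
@[route_item "route-NavierStokesRegularity-PeriodicPortability", crux]
def BlowupPeriodises : Prop :=
  ∀ ν : ℝ, 0 < ν → ∀ u₀ : EuclideanSpace ℝ (Fin 3) → EuclideanSpace ℝ (Fin 3), ContDiff ℝ (⊤ : ℕ∞) u₀ → Literature.Analysis.FluidPDE.NSWave0.IsDivFree u₀ → Literature.Analysis.FluidPDE.HasRapidSpatialDecay u₀ → (¬ ∃ (u : ℝ → EuclideanSpace ℝ (Fin 3) → EuclideanSpace ℝ (Fin 3)) (p : ℝ → EuclideanSpace ℝ (Fin 3) → ℝ), Literature.Analysis.FluidPDE.IsSmoothOnHalfSpace u ∧ Literature.Analysis.FluidPDE.IsSmoothOnHalfSpace p ∧ Literature.Analysis.FluidPDE.IsNavierStokesSolution ν 0 u₀ u p ∧ Literature.Analysis.FluidPDE.HasBoundedEnergy u) →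 ∃ ψ : EuclideanSpace ℝ (Fin 3) → EuclideanSpace ℝ (Fin 3), ContDiff ℝ (⊤ : ℕ∞) ψ ∧ Literature.Analysis.FluidPDE.NSWave0.IsDivFree ψ ∧ Literature.Analysis.FluidPDE.IsLatticePeriodic ψ ∧ ¬ ∃ (v : ℝ → EuclideanSpace ℝ (Fin 3) → EuclideanSpace ℝ (Fin 3)) (q : ℝ → EuclideanSpace ℝ (Fin 3) → ℝ), Literature.Analysis.FluidPDE.IsSmoothOnHalfSpace v ∧ Literature.Analysis.FluidPDE.IsSmoothOnHalfSpace q ∧ Literature.Analysis.FluidPDE.IsNavierStokesSolution ν 0 ψ v q ∧ ∀ t, 0 ≤ t → Literature.Analysis.FluidPDE.IsLatticePeriodic (v t)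

/-- item stmt-NavierStokesRegularity-16045 · crux (kind.auto-crux: conjecture-grade) · rank 9 · open · by planner
why it might fail: auto-crux — conjecture-grade statement (docstring avows it ('CONJECTURE')); it is open, so it may simply be false
sources: FeffermanClay2006, Tao2011
[support] THE DECLARED CONDITION of this conditional bridge (never to be staffed here): printed Clay
(B), written out verbatim = the body of the registered OPEN CONJECTURE
`Literature.Analysis.FluidPDE.NavierStokesExistenceSmoothPeriodic` (`ClayB ↔
NavierStokesExistenceSmoothPeriodic` is `Iff.rfl`, checked in Sketch.lean): for every ν > 0 every
smooth divergence-free ℤ³-periodic datum has a jointly smooth solution (u,p) on ℝ³×[0,∞) with u(·,t)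
periodic. [difficulty: open-problem] -/
@[route_item "route-NavierStokesRegularity-PeriodicPortability", crux]
def ClayB : Prop :=
  ∀ ν : ℝ, 0 < ν → ∀ u₀ : EuclideanSpace ℝ (Fin 3) → EuclideanSpace ℝ (Fin 3), ContDiff ℝ (⊤ : ℕ∞) u₀ → Literature.Analysis.FluidPDE.NSWave0.IsDivFree u₀ → Literature.Analysis.FluidPDE.IsLatticePeriodic u₀ → ∃ (u : ℝ → EuclideanSpace ℝ (Fin 3) → EuclideanSpace ℝ (Fin 3)) (p : ℝ → EuclideanSpace ℝ (Fin 3) → ℝ), Literature.Analysis.FluidPDE.IsSmoothOnHalfSpace u ∧ Literature.Analysis.FluidPDE.IsSmoothOnHalfSpace p ∧ Literature.Analysis.FluidPDE.IsNavierStokesSolution ν 0 u₀ u p ∧ ∀ t, 0 ≤ t → Literature.Analysis.FluidPDE.IsLatticePeriodic (u t)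

/-- item stmt-NavierStokesRegularity-16043 · support · rank 9 · open · by planner
sources: RusinSverak2011, Tao2011, arXiv:2008.04725, GallagherIftimiePlanchon2003
[support] (2001 TRP Thm t:periodic "whole-space blow-up forces unbounded periodic amplification",
L³-cell/sup-norm form, claim-level in 2001 — to be re-proved here) under the hypotheses of the crux
there is M such that for every A some smooth divergence-free ℤ³-periodic MEAN-ZERO datum ψ with
‖ψ‖_(L³(unit cell)) ≤ M has: every GLOBAL classical periodic solution (v and q periodic) from ψ
reaches √t‖v(t)‖_∞ ≥ A at some t > 0 (mean zero + periodic pressure exclude Galilean drift, so this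
is genuine critical amplification at a bounded critical level; proof sketch: evolve to u(t₀),
solenoidally truncate at R ≫ 1, rescale into the unit torus, compare periodic and whole-space
evolutions up to t₁ < T by the energy method on the difference with CKN/ε-regularity control of the
far field, and use blow-up of the whole-space sup-norm rate ‖u(t)‖_∞ ≥ c(ν/(T−t))^(1/2)).
[difficulty: M] -/
@[route_item "route-NavierStokesRegularity-PeriodicPortability"]
def PeriodicAmplificationTransplant : Prop :=
  ∀ ν : ℝ, 0 < ν → ∀ T : ℝ, 0 < T → ∀ (u : ℝ → EuclideanSpace ℝ (Fin 3) → EuclideanSpace ℝ (Fin 3)) (p : ℝ → EuclideanSpace ℝ (Fin 3) → ℝ), Literature.Analysis.FluidPDE.IsClassicalNSSolutionOn (Set.Ico 0 T) ν 0 u p → Literature.Analysis.FluidPDE.IsLerayHopfOn T ν 0 (u 0) u → Literature.Analysis.FluidPDE.HasRapidSpatialDecay (u 0) → ¬ Literature.Analysis.FluidPDE.HasSmoothExtensionPast ν 0 u T → ∃ M : ℝ, ∀ A : ℝ, ∃ ψ : EuclideanSpace ℝ (Fin 3) → EuclideanSpace ℝ (Fin 3), ContDiff ℝ (⊤ : ℕ∞)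 ψ ∧ Literature.Analysis.FluidPDE.NSWave0.IsDivFree ψ ∧ Literature.Analysis.FluidPDE.IsLatticePeriodic ψ ∧ (∫ x in {x : EuclideanSpace ℝ (Fin 3) | ∀ i, x i ∈ Set.Ico (0 : ℝ) 1}, ψ x = 0) ∧ eLpNorm ψ 3 (volume.restrict {x : EuclideanSpace ℝ (Fin 3) | ∀ i, x i ∈ Set.Ico (0 : ℝ) 1}) ≤ ENNReal.ofReal M ∧ ∀ (v : ℝ → EuclideanSpace ℝ (Fin 3) → EuclideanSpace ℝ (Fin 3)) (q : ℝ → EuclideanSpace ℝ (Fin 3) → ℝ), Literature.Analysis.FluidPDE.IsClassicalNSSolutionOn (Set.Ici 0) ν 0 v q → v 0 = ψ → (∀ t, 0 ≤ t → Literature.Analysis.FluidPDE.IsLatticePeriodic (v t)) → (∀ t, 0 ≤ t → Literature.Analysis.FluidPDE.IsLatticePeriodic (q t)) → ∃ t : ℝ, 0 < t ∧ ENNReal.ofReal A ≤ ENNReal.ofReal (Real.sqrt t) * eLpNorm (v t) ⊤ volume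

/-- item stmt-NavierStokesRegularity-16044 · support · rank 9 · open · by planner
sources: BradshawTsai2017CPDE, arXiv:2607.09619, Tao2011, RusinSverak2011
[support] (periodic twin of the shared bridge RdssProfileTruncation of routes
FilamentSkeletonRss/DssFarFieldSlaving; engine = the 2001 wall-(a) theorem W-T, proved there four
times) a nontrivial Type-I rotated discretely self-similar ancient mild profile (ν = 1, measurable
slices, |u| ≤ C₀/(|x|+√−t)) forces the failure of printed Clay (B) at ν = 1: land the truncated,
periodised profile on the finite-codimension strong-stable manifold of the profile's periodic orbit
in L^p_σ similarity variables (3 < p < ∞), the periodic images being an exponentially receding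
perturbation as s → ∞; the Galilean normalisation (NSWave0 module docstring) turns "periodic mild
blow-up" into "no printed-(B) solution". [difficulty: L] -/
@[route_item "route-NavierStokesRegularity-PeriodicPortability"]
def RdssProfilePeriodises : Prop :=
  (∃ (c : ℝ) (R : EuclideanSpace ℝ (Fin 3) ≃ₗᵢ[ℝ] EuclideanSpace ℝ (Fin 3)) (u : ℝ → EuclideanSpace ℝ (Fin 3) → EuclideanSpace ℝ (Fin 3)), 1 < c ∧ Literature.Analysis.FluidPDE.IsAncientMildSolution 1 u ∧ (∀ t < 0, AEStronglyMeasurable (u t) volume) ∧ Literature.Analysis.FluidPDE.IsRotatedDSS c R u ∧ (∃ C₀ : ℝ, Literature.Analysis.FluidPDE.HasTypeIDecay C₀ u) ∧ ¬ (∀ t < 0, u t =ᵐ[volume] 0)) → ∃ ψ : EuclideanSpace ℝ (Fin 3) → EuclideanSpace ℝ (Fin 3), ContDiff ℝ (⊤ : ℕ∞) ψ ∧ Literature.Analysis.FluidPDE.NSWave0.IsDivFree ψ ∧ Literature.Analysis.FluidPDE.IsLatticePeriodic ψ ∧ ¬ ∃ (v : ℝ → EuclideanSpace ℝ (Fin 3)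 → EuclideanSpace ℝ (Fin 3)) (q : ℝ → EuclideanSpace ℝ (Fin 3) → ℝ), Literature.Analysis.FluidPDE.IsSmoothOnHalfSpace v ∧ Literature.Analysis.FluidPDE.IsSmoothOnHalfSpace q ∧ Literature.Analysis.FluidPDE.IsNavierStokesSolution 1 0 ψ v q ∧ ∀ t, 0 ≤ t → Literature.Analysis.FluidPDE.IsLatticePeriodic (v t)

/-- item stmt-NavierStokesRegularity-16046 · assembly · rank 1 · closed · proved by Summit.NavierStokesRegularity.NavierStokesRegularity.Theorems.periodicPortability_assembly_proof (prover) · by planner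
sources: Tao2011, FeffermanClay2006
[assembly] BlowupPeriodises → ClayB (printed Clay (B), the declared condition) →
NavierStokesRegularity, through NoBlowupToClay. -/
@[route_item "route-NavierStokesRegularity-PeriodicPortability"]
def Assembly : Prop :=
  BlowupPeriodises → ClayB → NavierStokesRegularity

-- `Assembly` holds: proved by `Summit.NavierStokesRegularity.NavierStokesRegularity.Theorems.periodicPortability_assembly_proof` (its module imports this route file, so no `_holds` link can be stated here).

/-! D-0027 §2.1 — DECIDING THEOREM (planner-authored via `route open/edit --closes-file`; by planner-rrepair-NavierStokesRegularity-Periodi-c77472d4-0 2026-08-16T18:07:07Z):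
its hypotheses are this route's items and its conclusion the sub-problem Statement (glue_lint), and it elaborates with this file. -/

@[closes "route-NavierStokesRegularity-PeriodicPortability"] theorem closes (hP : BlowupPeriodises) (hB : ClayB) : NavierStokesRegularity := by
  -- pure logic over the two crux items (rev 6, cone route-repair): no Theorems import, no support hypothesis.
  intro ν hν u₀ hs hd hdec
  by_contra hno
  obtain ⟨ψ, hψs, hψd, hψp, hnone⟩ := hP ν hν u₀ hs hd hdec hno
  exact hnone (hB ν hν ψ hψs hψd hψp)

end Summit.NavierStokesRegularity.NavierStokesRegularity.Theses.PeriodicPortability
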